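import Summits.AnomalousDissipation.AnomalousDissipation.Theorems.SolenoidalFractalHomogenisationRealisedQuasiStaticCellLawSectorWindow
import Summits.AnomalousDissipation.AnomalousDissipation.Theorems.SolenoidalFractalHomogenisationRealisedQuasiStaticCellLawSlotTimes
import Summits.AnomalousDissipation.AnomalousDissipation.Theorems.SolenoidalFractalHomogenisationRealisedQuasiStaticCellLawPeriodicContraction
import HarnessLib

/-!
# K2R `RealisedQuasiStaticCellLaw`, line `floquet-bloch`: exponential decay of the total truncation energy of a low Bloch
# sector, uniformly in the truncation order (helper towards `stub_lowSectorDecay`; `--supports stmt-AnomalousDissipation-20446`)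

Summits-side helper file (everything proved; no definitions, no named facts). The per-period composition of STUB-PLAN
`stub_lowSectorDecay` §3.5–3.6 for the Galerkin truncations of the cell problem: the total energy
`E_N(t) = ∑_{k∈freqBall N} ‖α_N(t)(k)‖²` is non-increasing (`blockEnergy_antitone_of_solution`), and on the good window of slot
`j` of every period (`slot_window_of_middle`; coupling `g_j = C·trap ∈ [C/2, C]` there, `C = 2πθ|a_j|/(nΛ_j)`, `θ = ê_j·ℓ > 0`) it
contracts by `sectorWindow_contraction`; `exp_decay_of_window_contraction` turns this into
`E_N(t) ≤ θ₀⁻¹ · exp(-(log θ₀⁻¹ / P) t) · E_N(0)` for all `t ≥ 0` with the explicit per-period factor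
`θ₀ = min 1 (max(2·(5/3)·e^{-r_P w}, e^{-8π²κ(n/2)² w}))`, `w = τ_j(1-ρ)` (`sectorEnergy_exp_decay`), uniformly in `N`. With
`ae_integral_norm_sq_le_of_galerkinBound` this is the shape of `stub_lowSectorDecay` for one sector, pending the comparison of
`log θ₀⁻¹ / P` with the crux rate.
-/

set_option linter.dupNamespace false

noncomputable section

namespace Summit.AnomalousDissipation.AnomalousDissipation.Theorems.SolenoidalFractalHomogenisation.RealisedQuasiStaticCellLaw

open Set MeasureTheory Filter Topology Function Matrix
open scoped InnerProductSpace ComplexConjugate Matrix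
open Literature.Analysis Literature.Analysis.FunctionSpaces Literature.Analysis.FunctionSpaces.Torus
open Literature.Analysis.FluidPDE Literature.Analysis.FluidPDE.LatticeShear
open Summit.AnomalousDissipation.AnomalousDissipation.Theorems.SolenoidalFractalHomogenisation.PermissibleCarrier

variable {k₀ : ℕ}

/-- **The total truncation energy of the cell problem is non-increasing on `[0, ∞)`.** -/
theorem totalEnergy_antitone (W : LatticeWord k₀) {n : ℕ} (hn : 0 < n) {κ : ℝ} (hκ : 0 ≤ κ)
    (ℓ : Fin 3 → ℤ) {w₀ : UnitAddTorus (Fin 3) → EuclideanSpace ℝ (Fin 3)}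
    (hw₀ : FunctionSpaces.Torus.MemSobolev 1 (FunctionSpaces.EuclideanSpace.complexify ∘ w₀))
    (hdiv : FunctionSpaces.Torus.IsWeaklyDivFree w₀) (hmean : FunctionSpaces.Torus.HasZeroMean w₀)
    (hsupp : ∀ k : Fin 3 → ℤ, ¬ ((∃ z : Fin 3 → ℤ, k = ℓ + (n:ℤ) • z) ∨ (∃ z : Fin 3 → ℤ, k = -ℓ + (n:ℤ) • z)) →
      UnitAddTorus.mFourierCoeff (FunctionSpaces.EuclideanSpace.complexify ∘ w₀) k = 0)
    (N : ℕ) {s t : ℝ} (hs : 0 ≤ s) (hst : s ≤ t) :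
    ∑ k ∈ freqBall N, ‖(pvSetup_cell W hn hκ ℓ hw₀ hdiv hmean hsupp).galerkinCoeffAt N t k‖ ^ 2 ≤
      ∑ k ∈ freqBall N, ‖(pvSetup_cell W hn hκ ℓ hw₀ hdiv hmean hsupp).galerkinCoeffAt N s k‖ ^ 2 := by
  set hPV := pvSetup_cell W hn hκ ℓ hw₀ hdiv hmean hsupp with hPVdef
  obtain ⟨-, hmemP, -, hsol, -⟩ := hPV.galerkinCoeff_spec N
  have hα : ∀ τ ∈ Icc s t, HasDerivWithinAt (hPV.galerkinCoeff N)
      (pvGalerkinRHS (freqBall N) κ (Torus.carrierTrunc (fun t k =>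
        UnitAddTorus.mFourierCoeff (EuclideanSpace.complexify ∘ W.cell n t) k) N τ) (hPV.galerkinCoeff N τ)) (Icc s t) τ :=
    fun τ hτ => (hsol t τ ⟨hs.trans hτ.1, hτ.2⟩).mono (Icc_subset_Icc_left hs)
  have h := Torus.blockEnergy_antitone_of_solution κ hκ (neg_mem_freqBall_of_mem (N := N))
    (fun τ => Torus.isRealCoeff_carrierTrunc hPV.carrier N τ) (fun τ => Torus.isSolenoidalCoeff_carrierTrunc hPV.carrier N τ)
    hα (fun τ _ => (hmemP τ).1) (Finset.Subset.refl _) (neg_mem_freqBall_of_mem (N := N))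
    (fun _ _ _ _ _ _ m hm _ _ _ => hm) t ⟨hst, le_rfl⟩
  simp only [hPV.coeffExt_galerkinCoeff] at h
  exact h

/-- **Exponential decay of the total truncation energy of a low sector, uniformly in `N`** (per-period composition). -/
theorem sectorEnergy_exp_decay (W : LatticeWord k₀) {n : ℕ} (hn : 0 < n) {κ : ℝ} (hκ : 0 < κ)
    (ℓ : Fin 3 → ℤ) (hℓn : 2 * ‖latticeVec ℓ‖ ≤ n) {w₀ : UnitAddTorus (Fin 3) → EuclideanSpace ℝ (Fin 3)}
    (hw₀ : FunctionSpaces.Torus.MemSobolev 1 (FunctionSpaces.EuclideanSpace.complexify ∘ w₀))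
    (hdiv : FunctionSpaces.Torus.IsWeaklyDivFree w₀) (hmean : FunctionSpaces.Torus.HasZeroMean w₀)
    (hsupp : ∀ k : Fin 3 → ℤ, ¬ ((∃ z : Fin 3 → ℤ, k = ℓ + (n:ℤ) • z) ∨ (∃ z : Fin 3 → ℤ, k = -ℓ + (n:ℤ) • z)) →
      UnitAddTorus.mFourierCoeff (FunctionSpaces.EuclideanSpace.complexify ∘ w₀) k = 0)
    {N : ℕ} (hBN : (Finset.univ.biUnion fun j : Fin k₀ =>
        ({(fun i => (W.phase j).m i * n), -(fun i => (W.phase j).m i * n)} : Finset (Fin 3 → ℤ))) ⊆ freqBall N)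
    (j : Fin k₀)
    (hk : ∀ J : ℤ, ℓ + J • (fun i => (W.phase j).m i * (n : ℤ)) ∈ freqBall N →
      ℓ + J • (fun i => (W.phase j).m i * (n : ℤ)) ≠ 0)
    {ζr : Fin 3 → ℝ} (hζ1 : ζr ⬝ᵥ ζr = 1) (hζ0 : ζr ⬝ᵥ (fun i => ((ℓ i : ℤ) : ℝ)) = 0)
    (hζK : ζr ⬝ᵥ (fun i => (((fun i => (W.phase j).m i * (n : ℤ)) i : ℤ) : ℝ)) = 0)
    {p : ℤ → Fin 3 → ℝ}
    (hp : ∀ J : ℤ, p J = (Real.sqrt ((fun i => (((ℓ + J • (fun i => (W.phase j).m i * (n : ℤ))) i : ℤ) : ℝ)) ⬝ᵥ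
        (fun i => (((ℓ + J • (fun i => (W.phase j).m i * (n : ℤ))) i : ℤ) : ℝ))))⁻¹ •
        (fun i => (((ℓ + J • (fun i => (W.phase j).m i * (n : ℤ))) i : ℤ) : ℝ)) ⨯₃ ζr)
    {Wset : Finset ℤ} (hW : ∀ J : ℤ, J ∈ Wset ↔ ℓ + J • (fun i => (W.phase j).m i * (n : ℤ)) ∈ freqBall N)
    (h0 : (0 : ℤ) ∈ Wset) (h1 : (1 : ℤ) ∈ Wset) (hm1 : (-1 : ℤ) ∈ Wset)
    (hs : ∀ J ∈ Wset, |p J ⬝ᵥ p (J + 1)| ≤ 1) (hγpos : 0 < (p 0 ⬝ᵥ p 1) ^ 2 + (p (-1) ⬝ᵥ p 0) ^ 2)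
    (hd0 : freqNormSq ℓ / freqNormSq (fun i => (W.phase j).m i * (n : ℤ)) ≤ 1)
    (hd : ∀ J ∈ Wset, J ≠ 0 →
      1 / 2 ≤ freqNormSq (ℓ + J • (fun i => (W.phase j).m i * (n : ℤ))) / freqNormSq (fun i => (W.phase j).m i * (n : ℤ)))
    (hd1 : freqNormSq (ℓ + (1 : ℤ) • (fun i => (W.phase j).m i * (n : ℤ))) /
      freqNormSq (fun i => (W.phase j).m i * (n : ℤ)) ≤ 2)
    (hdm1 : freqNormSq (ℓ + (-1 : ℤ) • (fun i => (W.phase j).m i * (n : ℤ))) /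
      freqNormSq (fun i => (W.phase j).m i * (n : ℤ)) ≤ 2)
    (hθ : 0 < ∑ i, (W.phase j).e i * (ℓ i : ℝ)) {t : ℝ} (ht : 0 ≤ t) :
    ∑ k ∈ freqBall N, ‖(pvSetup_cell W hn hκ.le ℓ hw₀ hdiv hmean hsupp).galerkinCoeffAt N t k‖ ^ 2 ≤
      (min 1 (max (2 * (5 / 3) * Real.exp (-(κ * (4 * Real.pi ^ 2 * freqNormSq (fun i => (W.phase j).m i * (n : ℤ))) *
            min 2 ((p 0 ⬝ᵥ p 1) ^ 2 + (p (-1) ⬝ᵥ p 0) ^ 2) *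
            (2 * Real.pi * (∑ i, (W.phase j).e i * (ℓ i : ℝ)) *
              ‖Complex.exp ((W.phase j).φ * Complex.I) *
                (1 / (2 * ((2 * Real.pi * ‖latticeVec (W.phase j).m‖ : ℝ) : ℂ) * Complex.I))‖ * (1 / (n : ℝ)) /
              (κ * (4 * Real.pi ^ 2 * freqNormSq (fun i => (W.phase j).m i * (n : ℤ)))) / 2) *
            min (2 * Real.pi * (∑ i, (W.phase j).e i * (ℓ i : ℝ)) *
              ‖Complex.exp ((W.phase j).φ * Complex.I) *
                (1 / (2 * ((2 * Real.pi * ‖latticeVec (W.phase j).m‖ : ℝ) : ℂ) * Complex.I))‖ * (1 / (n : ℝ)) /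
              (κ * (4 * Real.pi ^ 2 * freqNormSq (fun i => (W.phase j).m i * (n : ℤ)))) / 2)
              (2 * Real.pi * (∑ i, (W.phase j).e i * (ℓ i : ℝ)) *
              ‖Complex.exp ((W.phase j).φ * Complex.I) *
                (1 / (2 * ((2 * Real.pi * ‖latticeVec (W.phase j).m‖ : ℝ) : ℂ) * Complex.I))‖ * (1 / (n : ℝ)) /
              (κ * (4 * Real.pi ^ 2 * freqNormSq (fun i => (W.phase j).m i * (n : ℤ)))))⁻¹ / 80) *
              ((W.phase j).τ * (1 - W.ramp))))
          (Real.exp (-(8 * Real.pi ^ 2 * κ * ((n : ℝ) / 2) ^ 2) * ((W.phase j).τ * (1 - W.ramp))))))⁻¹ *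
        Real.exp (-(Real.log (min 1 (max (2 * (5 / 3) * Real.exp (-(κ * (4 * Real.pi ^ 2 *
            freqNormSq (fun i => (W.phase j).m i * (n : ℤ))) *
            min 2 ((p 0 ⬝ᵥ p 1) ^ 2 + (p (-1) ⬝ᵥ p 0) ^ 2) *
            (2 * Real.pi * (∑ i, (W.phase j).e i * (ℓ i : ℝ)) *
              ‖Complex.exp ((W.phase j).φ * Complex.I) *
                (1 / (2 * ((2 * Real.pi * ‖latticeVec (W.phase j).m‖ : ℝ) : ℂ) * Complex.I))‖ * (1 / (n : ℝ)) /
              (κ * (4 * Real.pi ^ 2 * freqNormSq (fun i => (W.phase j).m i * (n : ℤ)))) / 2) *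
            min (2 * Real.pi * (∑ i, (W.phase j).e i * (ℓ i : ℝ)) *
              ‖Complex.exp ((W.phase j).φ * Complex.I) *
                (1 / (2 * ((2 * Real.pi * ‖latticeVec (W.phase j).m‖ : ℝ) : ℂ) * Complex.I))‖ * (1 / (n : ℝ)) /
              (κ * (4 * Real.pi ^ 2 * freqNormSq (fun i => (W.phase j).m i * (n : ℤ)))) / 2)
              (2 * Real.pi * (∑ i, (W.phase j).e i * (ℓ i : ℝ)) *
              ‖Complex.exp ((W.phase j).φ * Complex.I) *
                (1 / (2 * ((2 * Real.pi * ‖latticeVec (W.phase j).m‖ : ℝ) : ℂ) * Complex.I))‖ * (1 / (n : ℝ)) /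
              (κ * (4 * Real.pi ^ 2 * freqNormSq (fun i => (W.phase j).m i * (n : ℤ)))))⁻¹ / 80) *
              ((W.phase j).τ * (1 - W.ramp))))
          (Real.exp (-(8 * Real.pi ^ 2 * κ * ((n : ℝ) / 2) ^ 2) * ((W.phase j).τ * (1 - W.ramp))))))⁻¹ /
          W.period) * t) *
        ∑ k ∈ freqBall N, ‖(pvSetup_cell W hn hκ.le ℓ hw₀ hdiv hmean hsupp).galerkinCoeffAt N 0 k‖ ^ 2 := by
  -- constants
  have hK0 : (fun i => (W.phase j).m i * (n : ℤ)) ≠ 0 := cellFreq_ne_zero (W.phase j) hn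
  have hKpos : 0 < freqNormSq (fun i => (W.phase j).m i * (n : ℤ)) := by
    obtain ⟨i, hi⟩ : ∃ i, (fun i => (W.phase j).m i * (n : ℤ)) i ≠ 0 := by
      by_contra h
      push Not at h
      exact hK0 (funext h)
    have hi' : (((W.phase j).m i * (n : ℤ) : ℤ) : ℝ) ≠ 0 := by exact_mod_cast hi
    unfold freqNormSq
    exact lt_of_lt_of_le (by positivity)
      (Finset.single_le_sum (fun l _ => sq_nonneg ((((W.phase j).m l * (n : ℤ) : ℤ) : ℝ))) (Finset.mem_univ i))
  have hΛpos : 0 < κ * (4 * Real.pi ^ 2 * freqNormSq (fun i => (W.phase j).m i * (n : ℤ))) := by positivity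
  have hnApos : 0 < ‖Complex.exp ((W.phase j).φ * Complex.I) *
                (1 / (2 * ((2 * Real.pi * ‖latticeVec (W.phase j).m‖ : ℝ) : ℂ) * Complex.I))‖ :=
    norm_pos_iff.2 (layerAmp_ne_zero (W.phase j))
  have hnpos : (0 : ℝ) < n := by exact_mod_cast hn
  obtain ⟨C, hC⟩ : ∃ C : ℝ, C = 2 * Real.pi * (∑ i, (W.phase j).e i * (ℓ i : ℝ)) *
      ‖Complex.exp ((W.phase j).φ * Complex.I) *
                (1 / (2 * ((2 * Real.pi * ‖latticeVec (W.phase j).m‖ : ℝ) : ℂ) * Complex.I))‖ * (1 / (n : ℝ)) /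
      (κ * (4 * Real.pi ^ 2 * freqNormSq (fun i => (W.phase j).m i * (n : ℤ)))) := ⟨_, rfl⟩
  have hCpos : 0 < C := by
    rw [hC]
    exact div_pos (mul_pos (mul_pos (mul_pos (mul_pos two_pos Real.pi_pos) hθ) hnApos) (by positivity)) hΛpos
  obtain ⟨w, hw⟩ : ∃ w : ℝ, w = (W.phase j).τ * (1 - W.ramp) := ⟨_, rfl⟩
  obtain ⟨M, hM⟩ : ∃ M : ℝ, M = max (2 * (5 / 3) * Real.exp (-(κ * (4 * Real.pi ^ 2 * freqNormSq (fun i => (W.phase j).m i * (n : ℤ))) *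
      min 2 ((p 0 ⬝ᵥ p 1) ^ 2 + (p (-1) ⬝ᵥ p 0) ^ 2) * (C / 2) * min (C / 2) C⁻¹ / 80) * w))
    (Real.exp (-(8 * Real.pi ^ 2 * κ * ((n : ℝ) / 2) ^ 2) * w)) := ⟨_, rfl⟩
  have hMpos : 0 < M := by rw [hM]; exact lt_max_of_lt_right (Real.exp_pos _)
  obtain ⟨θ₀, hθ₀⟩ : ∃ θ₀ : ℝ, θ₀ = min 1 M := ⟨_, rfl⟩
  have hθ₀pos : 0 < θ₀ := by rw [hθ₀]; exact lt_min one_pos hMpos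
  have hθ₀le : θ₀ ≤ 1 := by rw [hθ₀]; exact min_le_left _ _
  have hP := period_pos W
  have hρτ : 0 < W.ramp * (W.phase j).τ := mul_pos W.ramp_pos (W.phase j).τ_pos
  obtain ⟨E, hE⟩ : ∃ E : ℝ → ℝ, E = fun τ =>
      ∑ k ∈ freqBall N, ‖(pvSetup_cell W hn hκ.le ℓ hw₀ hdiv hmean hsupp).galerkinCoeffAt N τ k‖ ^ 2 := ⟨_, rfl⟩
  have hEnn : ∀ τ, 0 ≤ E τ := fun τ => by rw [hE]; exact Finset.sum_nonneg fun k _ => by positivity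
  -- the energy is non-increasing
  have hmono : ∀ s τ, 0 ≤ s → s ≤ τ → E τ ≤ E s := fun s τ hs0 hsτ => by
    rw [hE]; exact totalEnergy_antitone W hn hκ.le ℓ hw₀ hdiv hmean hsupp N hs0 hsτ
  -- the windows
  obtain ⟨a, ha⟩ : ∃ a : ℕ → ℝ, a = fun q : ℕ => (q : ℝ) * W.period + W.start j + W.ramp * (W.phase j).τ / 2 := ⟨_, rfl⟩
  obtain ⟨b, hb⟩ : ∃ b : ℕ → ℝ, b = fun q : ℕ =>
      (q : ℝ) * W.period + W.start j + (W.phase j).τ - W.ramp * (W.phase j).τ / 2 := ⟨_, rfl⟩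
  have ha' : ∀ q : ℕ, (q : ℝ) * W.period ≤ a q := fun q => by
    rw [ha]; linarith [start_nonneg W j, hρτ]
  have hab : ∀ q : ℕ, a q ≤ b q := fun q => by
    have := slot_window_nonempty W j (q : ℤ)
    rw [ha, hb]; push_cast at this; linarith
  have hb' : ∀ q : ℕ, b q ≤ ((q + 1 : ℕ) : ℝ) * W.period := fun q => by
    have := start_add_tau_le_period W j
    rw [hb]; push_cast; nlinarith [hρτ]
  have hwin : ∀ q : ℕ, ∀ τ ∈ Icc (a q) (b q),
      Int.fract (τ / W.period) * W.period ∈ Icc (W.start j) (W.start j + (W.phase j).τ) ∧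
        1 / 2 ≤ LatticeWord.trapezoid (W.start j) (W.phase j).τ W.ramp (Int.fract (τ / W.period) * W.period) := by
    intro q τ hτ
    rw [ha, hb] at hτ
    have h := slot_window_of_middle W j (q : ℤ) (t := τ) (by push_cast; exact hτ)
    exact h
  -- per-window contraction
  have hcontr : ∀ q : ℕ, E (b q) ≤ θ₀ * E (a q) := by
    intro q
    have ha0 : 0 ≤ a q := le_trans (by positivity) (ha' q)
    have hg : ∀ τ ∈ Ioo (a q) (b q),
        C / 2 ≤ 2 * Real.pi * (∑ i, (W.phase j).e i * (ℓ i : ℝ)) *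
            ‖Complex.exp ((W.phase j).φ * Complex.I) *
                (1 / (2 * ((2 * Real.pi * ‖latticeVec (W.phase j).m‖ : ℝ) : ℂ) * Complex.I))‖ *
            ((1 / (n : ℝ)) * LatticeWord.trapezoid (W.start j) (W.phase j).τ W.ramp (Int.fract (τ / W.period) * W.period)) /
          (κ * (4 * Real.pi ^ 2 * freqNormSq (fun i => (W.phase j).m i * (n : ℤ)))) ∧
        2 * Real.pi * (∑ i, (W.phase j).e i * (ℓ i : ℝ)) *
            ‖Complex.exp ((W.phase j).φ * Complex.I) *
                (1 / (2 * ((2 * Real.pi * ‖latticeVec (W.phase j).m‖ : ℝ) : ℂ) * Complex.I))‖ *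
            ((1 / (n : ℝ)) * LatticeWord.trapezoid (W.start j) (W.phase j).τ W.ramp (Int.fract (τ / W.period) * W.period)) /
          (κ * (4 * Real.pi ^ 2 * freqNormSq (fun i => (W.phase j).m i * (n : ℤ)))) ≤ C := by
      intro τ hτ
      have htr := (hwin q τ (Ioo_subset_Icc_self hτ)).2
      have htr1 := trapezoid_le_one (W.start j) (W.phase j).τ W.ramp (Int.fract (τ / W.period) * W.period)
      have e : 2 * Real.pi * (∑ i, (W.phase j).e i * (ℓ i : ℝ)) *
            ‖Complex.exp ((W.phase j).φ * Complex.I) *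
                (1 / (2 * ((2 * Real.pi * ‖latticeVec (W.phase j).m‖ : ℝ) : ℂ) * Complex.I))‖ *
            ((1 / (n : ℝ)) * LatticeWord.trapezoid (W.start j) (W.phase j).τ W.ramp (Int.fract (τ / W.period) * W.period)) /
          (κ * (4 * Real.pi ^ 2 * freqNormSq (fun i => (W.phase j).m i * (n : ℤ)))) =
          C * LatticeWord.trapezoid (W.start j) (W.phase j).τ W.ramp (Int.fract (τ / W.period) * W.period) := by
        rw [hC]; ring
      rw [e]
      constructor <;> nlinarith
    have hSW := sectorWindow_contraction W hn hκ ℓ hℓn hw₀ hdiv hmean hsupp hBN ha0 le_rfl (hab q) j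
      (fun τ hτ => (hwin q τ hτ).1) hk hζ1 hζ0 hζK hp hW h0 h1 hm1 hs hγpos hd0 hd hd1 hdm1 (half_pos hCpos)
      (by linarith) hg
    have hwq : b q - a q = w := by rw [ha, hb, hw]; ring
    rw [hwq, ← hM] at hSW
    have h1 : E (b q) ≤ M * E (a q) := by rw [hE]; exact hSW
    have h2 : E (b q) ≤ 1 * E (a q) := by rw [one_mul]; exact hmono _ _ ha0 (hab q)
    rw [hθ₀, min_mul_of_nonneg _ _ (hEnn (a q))]
    exact le_min h2 h1
  have hmain := exp_decay_of_window_contraction hP hθ₀pos hθ₀le (hEnn 0) hmono a b ha' hab hb' hcontr ht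
  rw [hE] at hmain
  rw [hθ₀, hM, hw, hC] at hmain
  exact hmain

end Summit.AnomalousDissipation.AnomalousDissipation.Theorems.SolenoidalFractalHomogenisation.RealisedQuasiStaticCellLaw

end
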